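import Literature.MathematicalPhysics.QuantumFieldTheory.BalabanImbrieJaffe1984to88.BIJ88Sect3Translations
import Literature.MathematicalPhysics.QuantumFieldTheory.BalabanImbrieJaffe1984to88.BIJ88Eq242HiggsCovarianceTorus
import Literature.MathematicalPhysics.QuantumFieldTheory.BalabanImbrieJaffe1984to88.BIJ85Ineq732SmallFieldRegion

/-!
# `BalabanImbrieJaffe1984to88.BIJ88ScalarTranslation330Torus` — T. Bałaban, J. Imbrie, A. Jaffe, *Effective action and cluster properties of
the abelian Higgs model*, Commun. Math. Phys. **114** (1988) 257–315 [BalabanImbrieJaffe1988], Sect. 3 p. 270 [PDF 14]: **the scalar-field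
translation (3.30) WITH ITS CORRECTION `C^{(0)}_{loc}(u₁)Q*(u₁)ψ` COMPOSED FROM THE OBJECTS OF RECORD on the torus** — r18's typed translation
`BIJ88Sect3Translations.phi330` takes the site function `corr = C^{(0)}_{loc}(u₁)Q*(u₁)ψ` as DATA; here that data is given ITS BODY (`corr330`):
`Q*(u₁)` = the adjoint of p31's one-step covariant block-average matrix `BIJ88DeltaLoc234Torus.qMatT u₁ 1` (= `qMatK u₁ 1 univ`), and `C^{(0)}_{loc}(u₁)` =
**(2.43) at the first step**, the primed random-walk sum `Σ′_ω C_ω` (p13's `BIJ88RandomWalk242.cLoc` over [6]'s walk terms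
`BIJ88Eq242Lattice.latticeCw`) of p31's charted, realified Dirichlet restriction (`BIJ88Eq242HiggsCovarianceTorus.reOp`) of the first-step scalar
operator `−Δ_{u₁} + aL^{−2}Q(u₁)*Q(u₁)` = p31's `nOp (aL⁻²) c u₁ 1 univ` (the (3.31) operator, r18's choice of record), re-assembled into a
complex kernel.

statement-level skeleton of published theorems with citation tags; proofs where landed; nothing here is a claim about the Yang–Mills mass gap

PDF held: `paper:balaban1988-cmp114-bij-abelian-higgs-effective-action` (journal page = PDF page + 256); pp. 264–265, 269–270 [PDF 8–9, 13–14]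
re-read this session from the text layer (`lit read … --pages 3-15`, files `p0008.txt`, `p0013.txt`, `p0014.txt`).

CITATION HEADER (lean-in-tree rule).  Part of the lit-balaban TYPED SKELETON (HOME `run/shared/lean/pub/lit-balaban/`), PHASE-2 proof seat p29
gen 34 (unit `lit-balaban-p29`; free-target protocol G.5-34(d): TAKING line HOME/STATUS.md 2026-08-23T12:41Z; owner r18 g27's word 11:47:51Z
«that (3.30)+(3.33)-scalar member is the natural continuation and is FREE»).  Row served: **C2.Eq3.30** of `HOME/lit-balaban-r18/ROWS-C2.md`
(owner r18; the owed member named in `lit-balaban-r18/AUDIT-C2S14-DEF-g26.md`: «`corr330 := cLoc-operator (k = 0) *ᵥ ((qMatT u₁ ·)ᴴ *ᵥ ψ)`»);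
cells on C2.Eq2.43 (the first-step instance of the local part); the sizes (cell on C2.Eq3.33, crude bound only) are the companion proof-lane file
`BIJ88ScalarTranslation330Size` — see HONEST SCOPE.

THE PRINTED TEXT (verbatim).  p. 270 [PDF 14]: *"The next step is a scalar field translation to remove the term linear in φ in (3.29). Again we
make a local translation, φ = φ^{(0)} + aL^{−2}Λ₇^{(0)}C^{(0)}_{loc}(u₁)Q*(u₁)ψ. (3.30)  Neglecting terms at ∂Λ₇^{(0)} and local terms [range O(r(e₀))]
of the order of e^{−cr(e₀)}, we obtain the basic quadratic forms in φ^{(0)} and ψ: ½⟨φ^{(0)}, (−Δ_{u₁} + aL^{−2}Q(u₁)*Q(u₁))φ^{(0)}⟩ + ½⟨Λ₈^{(0)′}ψ,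
Δ^L_{1,loc}(u₁)Λ₈^{(0)′}ψ⟩. (3.31)"*  p. 264 [PDF 8]: *"We define C^{(k)}_Λ(u) = [(Δ_{k,loc}(u) + aL^{−2}Q(u)*Q(u)|_Λ]^{−1}. (2.40) This is of course a
nonlocal operator, but by (2.38), C^{(k)}_Λ(u)^{−1} is bounded below and a random walk expansion as in [6] can be used … The basic expansion has the
form C^{(k)}_Λ(u; x₁, x₂) = Σ_ω C^{(k)}_{Λ,ω}(u, x₁, x₂), (2.42) where ω is a walk on a lattice of spacing M = O(1). We define the localized form of
C^{(k)}_Λ(u) to be C^{(k)}_{Λ,loc}(u; x₁, x₂) = Σ′_ω C^{(k)}_{Λ,ω}(x₁, x₂), (2.43) where the prime indicates that only ω remaining within ¼r(e_k) of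
x₁, x₂ are included. … The local part C^{(k)}_{Λ,loc}(u; x₁, x₂) depends only on u in an O(r(e_k)) neighborhood of x₁, x₂; it vanishes for |x₁ − x₂| >
½r(e_k) and is bounded as in (2.41)."*  p. 265 [PDF 9]: *"Here −Δ^ε_u = D^{ε*}_u D^ε_u"*.

THE OBJECTS (tori of `Balaban1983to89.Setup`; fine level `j` = the unit lattice `T₁` of Sect. 3, block fields `ψ` on `T^{(j+1)}`; `c` = the inverse
lattice constant of p31's `covD c` — print: `c = 1`; `κ` STANDS FOR THE PRINTED `aL^{−2}` in §§1–3, entered as `a * L ^ (-2)` in §4 to match r18's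
`phi330 Λ₇ a L`).
* `lapU c U = D_uᴴD_u` — THE COVARIANT LAPLACIAN `−Δ_u` of the whole unit torus as a matrix (p31's Neumann-cut `dN c U univ`, no cut at `Ω = T`);
  at the first step it is the `Δ`-slot of (2.40) (`Δ_{0,loc} = −Δ_{u₁}`: the φ-form of (3.29)/(3.31) is `½⟨φ, (−Δ_{u₁} + aL^{−2}Q*Q)φ⟩`), so that
  THE (3.31) OPERATOR OF RECORD `nOp κ c U 1 univ` IS p31's (2.40)-shape `op240 (lapU c U) κ U` (`nOp_univ_eq_op240`).
* `cLocC Λ H M ρ` — **(2.43) AS A COMPLEX KERNEL** for any operator `H` on `ℓ²(T^{(j)})` with Dirichlet region `Λ`: the entry `(x₁, x₂)`, `x₁, x₂ ∈ Λ`,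
  is `Σ′_ω C_ω((x₁,Re),(x₂,Re)) + i·Σ′_ω C_ω((x₁,Im),(x₂,Re))` — the primed sum (walks with every cube within `ρ` labels of `x₁` AND of `x₂`, p13's
  `cLoc (ldist M) ρ`) of [6]'s walk terms of the charted real operator `reOp Λ H` (p31's complex-walk-term convention of `hasSum_walkTerms_inv`);
  `0` off `Λ × Λ`.
* `corr330 Λ κ c U M ρ ψ = C^{(0)}_{Λ,loc}(u₁) *ᵥ (Q(u₁)ᴴ *ᵥ ψ)` — THE CORRECTION OF (3.30) WITH BODY, `C^{(0)}_{Λ,loc}(u₁) = cLocC Λ (nOp κ c U 1 univ) M ρ`.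

WHAT IS PROVED (kernel-checked, 0 `sorry`; definitions with bodies `lapU`, `cLocC`, `corr330`; no `Prop`-valued fact, D-0026).
* §1 `form_lapU` (`φᴴ(−Δ_u)φ = Σ_b‖(D_uφ)(b)‖²`), `re_form_lapU_eq` (the (2.38)-SHAPE bound of p31's `hyp56_op240_smallField` holds for `−Δ_u` with
  `γ = c²`, `E = 0`, AS AN EQUALITY), `lapU_isHermitian`, **`nOp_univ_eq_op240`**, `re_form_nOp_univ` (`Re φᴴ(−Δ_u + κQ*Q)φ = Σ_b‖D_uφ(b)‖² +
  κΣ_y‖(Q(u)φ)(y)‖²` — the first basic form of (3.31) is r18's business, `BIJ88BasicForms331Torus`; here only the identity needed downstream).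
* §2 `cLocC_of_not_mem_left/right`, `cLocC_re` / `cLocC_im` (the entries ARE p13's primed sums), **`cLocC_eq_zero_of_far`** (*"it vanishes for
  |x₁ − x₂| > ½r(e_k)"*: `2ρ < |x₁−x₂|_chart/M ⇒ 0`, p13's `cLoc_eq_zero_of_far` through p31's chart), **`norm_cLocC_le_walk`** (*"bounded as in (2.41)"*:
  under [6] (5.6) of the charted operator, `‖C_{Λ,loc}(x₁,x₂)‖ ≤ 2K·e^{−(δ₀/8)|x₁−x₂|_chart/M}`, p31's `abs_cLoc_le_walk` on both real coordinates),
  **`norm_cLocC_sub_inv_le_walk`** ((2.47) in complex form: `‖C_{Λ,loc}(x₁,x₂) − C_Λ(x₁,x₂)‖ ≤ 2K′e^{−(δ₀/16)(ρ−3)}e^{−(δ₀/16)|x₁−x₂|_chart/M}`,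
  `C_Λ = (H|_Λ)^{−1}` = p31's `(compress Λ H)⁻¹`, from p31's `close247_walk`).
* §3 `corr330_apply`, `corr330_eq_qMatK`, **`qstar_mulVec_apply`** (`(Q(u)ᴴψ)(x) = conj(L^{−d}u(Γ_{x}))·ψ(y_x)`: one block row per site), **`norm_qstar_mulVec`**
  (`‖(Q(u)ᴴψ)(x)‖ = L^{−d}‖ψ(y_x)‖`), `corr330_of_not_mem` (`0` off `Λ`).
* §4 THE TYPED DISPLAY AT THE COMPOSED CORRECTION (r18's `phi330` BY NAME): **`phi330_corr330_of_mem`** / `_of_not_mem` ((3.30) inside / outside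
  `Λ₇`), `phi0_eq_sub` ((3.30) solved for the new variable `φ^{(0)} = φ − aL^{−2}Λ₇corr`), **`phi330_corr330_eq_mulVec`** — THE (5.8.1) / `Ops.T`
  SHAPE AT KERNEL LEVEL: `φ = φ^{(0)} + (aL^{−2})·(1_{Λ₇}·C^{(0)}_{Λ,loc}(u₁)·Q(u₁)ᴴ)ψ` with p31's projection `proj Λ₇` (r16's End-carrier
  `BIJ88ScalarSummary583.Ops.T = a • (Λ7 ∘ₗ Cloc ∘ₗ Qst)` read on matrices).
HONEST SCOPE.  (i) Definitions, composition, the two printed clauses of (2.43) and (2.47) for the composed kernel UNDER [6] (5.6) of the charted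
operator as a HYPOTHESIS (`B4.Hyp56`); its discharge for `−Δ_{u₁} + aL^{−2}Q(u₁)*Q(u₁)` at a small field `u₁` on a no-wrap `Λ` (p31's
`hyp56_op240_smallField` at `Δ := lapU`, (2.38)-shape bound exact by `re_form_lapU_eq`, range-one kernel) and the SIZE `‖corr330 x‖ ≤ C·sup‖ψ‖` with
the crude bound `‖φ^{(0)}(x)‖ ≤ ‖φ(x)‖ + aL^{−2}C·sup‖ψ‖` are the companion proof-lane file `BIJ88ScalarTranslation330Size` (same seat).  (ii) NOT here:
the realified End/Hilbert-carrier instance of r16's `Ops` (so p02's `BIJ88BasicForms331.eq331` is not instantiated at these kernels), print's λ-free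
(3.33) bound *"|φ^{(0)}| ≦ cp(e₀)"* (the fluctuation mechanism `φ^{(0)} = C D*(D_uφ) − aL^{−2}CQ*(ψ − Qφ) +` localization error), the `u`-locality
clause of (2.43) for this operator (p31's `BIJ88DeltaLocULocalityTorus.cLoc_congr_bonds` pattern), the sizes *"of the order of e^{−cr(e₀)}"* of the
neglected terms.  (iii) The Dirichlet region `Λ` of (2.40), the walk data `M` (print: `M = O(1)`), `ρ` (print: `ρM = ¼r(e₀)`) and the translation
region `Λ₇` are free parameters ((2.48): for `x` deep inside `Λ` the local kernel does not depend on `Λ`).  (iv) REAL COORDINATES: the complex kernel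
is assembled from the first column of the realified `2 × 2` blocks (p31's convention); that the walk terms commute with multiplication by `i` is not
claimed.  (v) Torus (periodic b.c.), `U(1)`, any `d ≥ 1`, standing range `j + 1 ≤ m + K` where block averages are unfolded.  Imports Literature only;
re-declares nothing (`nOp`, `qMatT`, `reOp`, `cLoc`, `latticeCw`, `compress`, `realify`, `phi330`, `proj` BY NAME); NOT summit progress; NOT continuum;
NOT Clay.
-/

open scoped BigOperators Matrix ComplexConjugate
open Finset Matrix

namespace Literature.MathematicalPhysics.QuantumFieldTheory.BalabanImbrieJaffe1984to88.BIJ88ScalarTranslation330Torus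

open Literature.MathematicalPhysics.QuantumFieldTheory.Balaban1983to89
open BIJ88Sect3Statements (U1 toC cfg covD starB mem_starB norm_toC)
open BIJ88Sect3Translations (phi330)
open BIJ85Ineq732SmallFieldRegion (norm_covD_sq)
open BIJ85BlockAveragesTorus BIJ85BlockAveragesTorusK
open BIJ88NeumannPropagator227Torus (nOp dN qMatK nOp_eq dN_mulVec qMatK_apply nOp_conjTranspose proj proj_mulVec)
open BIJ88DeltaLoc234Torus (qMatT qMatT_apply)
open BIJ88Eq240FlatTorus (realify compress op240 pOp re_form_op240)
open BIJ88Decay241FlatTorus (realify_apply_fst realify_apply_snd)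
open BIJ88RandomWalk242 BIJ88Eq242Lattice BIJ88Ineq246Lattice B4Sect5CubeBounds
open BIJ88Eq242HiggsCovarianceTorus

noncomputable section

variable {P : Params} {j : ℕ}

/-! ## §1  `−Δ_u = D_uᴴD_u` on the whole unit torus; the (3.31) operator `nOp κ c u 1 univ` IS p31's (2.40)-shape `op240 (−Δ_u) κ u` -/

section Laplacian

/-- **`−Δ_u = D_u^*D_u`** (p. 265 *"Here −Δ^ε_u = D^{ε*}_u D^ε_u"*; the `½⟨φ, −Δ_uφ⟩` of (3.29) and the `−Δ_{u₁}` of (3.31)) as a matrix on ALL sites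
of the unit torus `T^{(j)}`: the Gram matrix of p31's covariant-derivative matrix with no Neumann cut (`dN c U univ`).  At the first step it fills
the `Δ`-slot of (2.40) (there is no earlier localization: `Δ_{0,loc} = −Δ_{u₁}`). [cite: BalabanImbrieJaffe1988, (3.31) p.270] -/
def lapU (c : ℝ) (U : GaugeField P j U1) : Matrix (Balaban1983to89.Site P j) (Balaban1983to89.Site P j) ℂ :=
  (dN c U univ)ᴴ * dN c U univ

/-- kernel (p31's private `form_gram`, copied with attribution): `vᴴ(AᴴA)v = Σ_i‖(Av)_i‖²`. [cite: BalabanImbrieJaffe1988, (3.31) p.270] -/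
private theorem form_gram {m n : Type*} [Fintype m] [Fintype n] (A : Matrix m n ℂ) (v : n → ℂ) :
    star v ⬝ᵥ ((Aᴴ * A) *ᵥ v) = ((∑ i, ‖(A *ᵥ v) i‖ ^ 2 : ℝ) : ℂ) := by
  rw [← mulVec_mulVec, dotProduct_mulVec, vecMul_conjTranspose, star_star]
  simp only [dotProduct, Pi.star_apply, Complex.ofReal_sum, Complex.ofReal_pow]
  refine Finset.sum_congr rfl fun i _ => ?_
  rw [Complex.star_def, ← Complex.normSq_eq_conj_mul_self, Complex.normSq_eq_norm_sq, Complex.ofReal_pow]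

/-- kernel: every bond of the torus lies in `T* = starB univ`. [cite: BalabanImbrieJaffe1988, (3.5) p.266] -/
theorem mem_starB_univ (b : PBond P j) : b ∈ starB (univ : Finset (Balaban1983to89.Site P j)) :=
  (mem_starB _ b).2 ⟨mem_univ _, mem_univ _⟩

/-- kernel: with no cut, p31's `dN` acts as the covariant derivative `D_u` on every bond. [cite: BalabanImbrieJaffe1988, (3.3) p.265] -/
theorem dN_univ_mulVec (c : ℝ) (U : GaugeField P j U1) (φ : Balaban1983to89.Site P j → ℂ) (b : PBond P j) :
    (dN c U univ *ᵥ φ) b = covD c (cfg U) φ b := by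
  rw [dN_mulVec, if_pos (mem_starB_univ b)]

/-- **the quadratic form of `−Δ_u`**: `φᴴ(−Δ_u)φ = Σ_b‖(D_uφ)(b)‖²` (the `⟨φ, −Δ_uφ⟩` of (3.29)). [cite: BalabanImbrieJaffe1988, (3.29) p.270] -/
theorem form_lapU (c : ℝ) (U : GaugeField P j U1) (φ : Balaban1983to89.Site P j → ℂ) :
    star φ ⬝ᵥ (lapU c U *ᵥ φ) = ((∑ b : PBond P j, ‖covD c (cfg U) φ b‖ ^ 2 : ℝ) : ℂ) := by
  rw [lapU, form_gram]
  congr 1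
  exact Finset.sum_congr rfl fun b _ => by rw [dN_univ_mulVec]

/-- **the (2.38)-SHAPE lower bound holds for `−Δ_u` AS AN EQUALITY**, `γ = c²`, `E = 0`: `c²Σ_b‖u(b)φ(b₊) − φ(b₋)‖² − 0·‖φ‖² = Re φᴴ(−Δ_u)φ` — the
hypothesis `h238` of p31's `hyp56_op240_smallField` / `isUnit_compress_op240_smallField` for the first-step `Δ`-slot, for EVERY field (no support
condition needed; summand identity = p31's `BIJ85Ineq732SmallFieldRegion.norm_covD_sq`). [cite: BalabanImbrieJaffe1988, (2.38) p.264] -/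
theorem re_form_lapU_eq (c : ℝ) (U : GaugeField P j U1) (φ : Balaban1983to89.Site P j → ℂ) :
    c ^ 2 * ∑ b : PBond P j, ‖toC (U b) * φ b.tgt - φ b.src‖ ^ 2 - 0 * ∑ x, ‖φ x‖ ^ 2 = (star φ ⬝ᵥ (lapU c U *ᵥ φ)).re := by
  rw [form_lapU, Complex.ofReal_re, zero_mul, sub_zero, Finset.mul_sum]
  exact Finset.sum_congr rfl fun b _ => by rw [norm_covD_sq]

/-- the (2.38)-shape hypothesis in the exact form p31's lemmas take (`≤`, fields supported in `Λ`). [cite: BalabanImbrieJaffe1988, (2.38) p.264] -/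
theorem h238_lapU (c : ℝ) (U : GaugeField P j U1) (Λ : Finset (Balaban1983to89.Site P j)) :
    ∀ φ : Balaban1983to89.Site P j → ℂ, (∀ x ∉ Λ, φ x = 0) →
      c ^ 2 * ∑ b : PBond P j, ‖toC (U b) * φ b.tgt - φ b.src‖ ^ 2 - 0 * ∑ x, ‖φ x‖ ^ 2 ≤ (star φ ⬝ᵥ (lapU c U *ᵥ φ)).re :=
  fun φ _ => (re_form_lapU_eq c U φ).le

/-- `−Δ_u` is Hermitian (a Gram matrix). [cite: BalabanImbrieJaffe1988, (3.31) p.270] -/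
theorem lapU_isHermitian (c : ℝ) (U : GaugeField P j U1) : (lapU c U).IsHermitian :=
  isHermitian_conjTranspose_mul_self _

/-- **THE (3.31) OPERATOR OF RECORD IS p31's (2.40)-SHAPE OPERATOR AT THE FIRST STEP**: on the whole fine torus (`Ω = T`, one averaging step)
`nOp κ c u 1 univ = −Δ_u + κQ(u)*Q(u) = op240 (−Δ_u) κ u` (`κ` = the printed `aL^{−2}`; `Q(u)*Q(u)` = p31's `pOp u`) — so every theorem p31 proved for
`[(Δ + κP(u))|_Λ]^{−1}` with a generic `Δ` applies to the first-step propagator `C^{(0)}_Λ(u₁)` of (2.40)/(3.30). [cite: BalabanImbrieJaffe1988, (2.40) p.264] -/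
theorem nOp_univ_eq_op240 (κ c : ℝ) (U : GaugeField P j U1) : nOp κ c U 1 univ = op240 (lapU c U) κ U := by
  rw [nOp_eq]
  rfl

/-- the real part of the first-step form: `Re φᴴ(−Δ_u + κQ*Q)φ = Σ_b‖(D_uφ)(b)‖² + κΣ_y‖(Q(u)φ)(y)‖²` (the two φ-terms of (3.29) at `ψ = 0`;
p31's `re_form_op240`). [cite: BalabanImbrieJaffe1988, (3.31) p.270] -/
theorem re_form_nOp_univ (κ c : ℝ) (U : GaugeField P j U1) (φ : Balaban1983to89.Site P j → ℂ) :
    (star φ ⬝ᵥ (nOp κ c U 1 univ *ᵥ φ)).re = ∑ b : PBond P j, ‖covD c (cfg U) φ b‖ ^ 2 + κ * ∑ y, ‖qCovK U 1 φ y‖ ^ 2 := by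
  rw [nOp_univ_eq_op240, re_form_op240, form_lapU, Complex.ofReal_re]

end Laplacian

/-! ## §2  (2.43) as a COMPLEX kernel for any charted torus operator: the primed walk sum re-assembled from its real coordinates -/

section LocalKernel

variable (Λ : Finset (Balaban1983to89.Site P j)) (H : Matrix (Balaban1983to89.Site P j) (Balaban1983to89.Site P j) ℂ) (M : ℕ) (ρ : ℝ)

/-- **(2.43) `C^{(k)}_{Λ,loc}(u; x₁, x₂) = Σ′_ω C^{(k)}_{Λ,ω}(x₁, x₂)` AS A COMPLEX KERNEL ON `T^{(j)}`** for the operator `H` with Dirichlet region `Λ`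
(print: `H = Δ_{k,loc}(u) + aL^{−2}Q(u)*Q(u)`; at the first step `H = −Δ_{u₁} + aL^{−2}Q(u₁)*Q(u₁)`): for `x₁, x₂ ∈ Λ` the complex number whose real
/ imaginary parts are p13's primed sums `cLoc (ldist M) ρ` — walks on the `M`-cubes of the charted `Λ` with every cube within `ρ` labels of `x₁` AND
of `x₂` (print: `ρM = ¼r(e_k)`) — of [6]'s walk terms `latticeCw` of p31's charted real operator `reOp Λ H`, read at the real coordinates
`((x₁,Re),(x₂,Re))` and `((x₁,Im),(x₂,Re))` (p31's complex walk-term convention, `hasSum_walkTerms_inv`); `0` when `x₁ ∉ Λ` or `x₂ ∉ Λ`.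
[cite: BalabanImbrieJaffe1988, (2.43) p.264] -/
def cLocC : Matrix (Balaban1983to89.Site P j) (Balaban1983to89.Site P j) ℂ := fun x₁ x₂ =>
  if h : x₁ ∈ Λ ∧ x₂ ∈ Λ then
    ⟨cLoc (ldist (N := 2) M) ρ (fun ω y₁ y₂ => latticeCw M (chartSet Λ) 2 (reOp Λ H) ω y₁ y₂)
        (idxEquiv Λ (⟨x₁, h.1⟩, 0)) (idxEquiv Λ (⟨x₂, h.2⟩, 0)),
      cLoc (ldist (N := 2) M) ρ (fun ω y₁ y₂ => latticeCw M (chartSet Λ) 2 (reOp Λ H) ω y₁ y₂)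
        (idxEquiv Λ (⟨x₁, h.1⟩, 1)) (idxEquiv Λ (⟨x₂, h.2⟩, 0))⟩
  else 0

variable {Λ H M ρ}

/-- `C_{Λ,loc}(x₁, x₂) = 0` for `x₁ ∉ Λ` (Dirichlet region). [cite: BalabanImbrieJaffe1988, (2.43) p.264] -/
theorem cLocC_of_not_mem_left {x₁ : Balaban1983to89.Site P j} (hx : x₁ ∉ Λ) (x₂ : Balaban1983to89.Site P j) : cLocC Λ H M ρ x₁ x₂ = 0 := by
  rw [cLocC, dif_neg (fun h => hx h.1)]

/-- `C_{Λ,loc}(x₁, x₂) = 0` for `x₂ ∉ Λ`. [cite: BalabanImbrieJaffe1988, (2.43) p.264] -/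
theorem cLocC_of_not_mem_right (x₁ : Balaban1983to89.Site P j) {x₂ : Balaban1983to89.Site P j} (hx : x₂ ∉ Λ) : cLocC Λ H M ρ x₁ x₂ = 0 := by
  rw [cLocC, dif_neg (fun h => hx h.2)]

/-- on `Λ × Λ` the kernel is the assembled complex number. [cite: BalabanImbrieJaffe1988, (2.43) p.264] -/
theorem cLocC_of_mem {x₁ x₂ : Balaban1983to89.Site P j} (h₁ : x₁ ∈ Λ) (h₂ : x₂ ∈ Λ) :
    cLocC Λ H M ρ x₁ x₂ =
      ⟨cLoc (ldist (N := 2) M) ρ (fun ω y₁ y₂ => latticeCw M (chartSet Λ) 2 (reOp Λ H) ω y₁ y₂) (idxEquiv Λ (⟨x₁, h₁⟩, 0)) (idxEquiv Λ (⟨x₂, h₂⟩, 0)),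
        cLoc (ldist (N := 2) M) ρ (fun ω y₁ y₂ => latticeCw M (chartSet Λ) 2 (reOp Λ H) ω y₁ y₂) (idxEquiv Λ (⟨x₁, h₁⟩, 1))
          (idxEquiv Λ (⟨x₂, h₂⟩, 0))⟩ := by
  rw [cLocC, dif_pos ⟨h₁, h₂⟩]

/-- **the real part IS p13's primed sum at `((x₁,Re),(x₂,Re))`**. [cite: BalabanImbrieJaffe1988, (2.43) p.264] -/
theorem cLocC_re (x₁ x₂ : ↥Λ) :
    (cLocC Λ H M ρ x₁ x₂).re =
      cLoc (ldist (N := 2) M) ρ (fun ω y₁ y₂ => latticeCw M (chartSet Λ) 2 (reOp Λ H) ω y₁ y₂) (idxEquiv Λ (x₁, 0)) (idxEquiv Λ (x₂, 0)) := by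
  rw [cLocC_of_mem x₁.2 x₂.2]

/-- **the imaginary part IS p13's primed sum at `((x₁,Im),(x₂,Re))`**. [cite: BalabanImbrieJaffe1988, (2.43) p.264] -/
theorem cLocC_im (x₁ x₂ : ↥Λ) :
    (cLocC Λ H M ρ x₁ x₂).im =
      cLoc (ldist (N := 2) M) ρ (fun ω y₁ y₂ => latticeCw M (chartSet Λ) 2 (reOp Λ H) ω y₁ y₂) (idxEquiv Λ (x₁, 1)) (idxEquiv Λ (x₂, 0)) := by
  rw [cLocC_of_mem x₁.2 x₂.2]

/-- kernel: p13's vanishing clause read through p31's chart (the one-liner of p31's `BIJ88DeltaLocULocalityTorus.cLoc_reOp_eq_zero_of_far`, any level).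
[cite: BalabanImbrieJaffe1988, (2.43) p.264] -/
theorem cLoc_chart_eq_zero_of_far {p q : ↥Λ × Fin 2} (hfar : 2 * ρ < cdist p.1.1 q.1.1 / M) :
    cLoc (ldist (N := 2) M) ρ (fun ω y₁ y₂ => latticeCw M (chartSet Λ) 2 (reOp Λ H) ω y₁ y₂) (idxEquiv Λ p) (idxEquiv Λ q) = 0 :=
  cLoc_eq_zero_of_far _ ρ _ (sdist (N := 2) M) (fun l x₁ x₂ => sdist_le_ldist_add l x₁ x₂) (by rwa [sdist, dist_idxEquiv])

/-- **(2.43), THE VANISHING CLAUSE** — *"it vanishes for |x₁ − x₂| > ½r(e_k)"*: `C_{Λ,loc}(x₁, x₂) = 0` as soon as `|x₁ − x₂|_chart/M > 2ρ`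
(`ρM = ¼r(e_k)`; no hypothesis on `H`). [cite: BalabanImbrieJaffe1988, (2.43) p.264] -/
theorem cLocC_eq_zero_of_far {x₁ x₂ : Balaban1983to89.Site P j} (hfar : 2 * ρ < cdist x₁ x₂ / M) : cLocC Λ H M ρ x₁ x₂ = 0 := by
  by_cases h : x₁ ∈ Λ ∧ x₂ ∈ Λ
  · rw [cLocC_of_mem h.1 h.2]
    apply Complex.ext
    · exact cLoc_chart_eq_zero_of_far (p := (⟨x₁, h.1⟩, 0)) (q := (⟨x₂, h.2⟩, 0)) hfar
    · exact cLoc_chart_eq_zero_of_far (p := (⟨x₁, h.1⟩, 1)) (q := (⟨x₂, h.2⟩, 0)) hfar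
  · rw [cLocC, dif_neg h]

/-- kernel: `‖z‖ ≤ |Re z| + |Im z|`. [cite: BalabanImbrieJaffe1988, (2.43) p.264] -/
private theorem norm_le_abs_re_add_abs_im (z : ℂ) : ‖z‖ ≤ |z.re| + |z.im| := Complex.norm_le_abs_re_add_abs_im z

variable {γ₀ c₀ δ₀ : ℝ}

/-- **(2.43), *"bounded as in (2.41)"*, FOR THE COMPLEX KERNEL**: if the charted real operator of `H|_Λ` satisfies [6] (5.6) (`B4.Hyp56 Λ′ · γ₀ c₀ δ₀`)
then for `M ≥ 5`, `M > K_R`, `M > Θ₁`, `θ_W < 1` (p13's constants at `d`, `N = 2`) and every `ρ`,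
`‖C_{Λ,loc}(x₁, x₂)‖ ≤ 2·2^dγ₀^{−1}(1−θ_W)^{−1}e^{δ₀/4}·e^{−(δ₀/8)|x₁−x₂|_chart/M}` — p31's `abs_cLoc_le_walk` on the two real coordinates.
[cite: BalabanImbrieJaffe1988, (2.43) p.264] -/
theorem norm_cLocC_le_walk (hγ : 0 < γ₀) (hc : 0 ≤ c₀) (hδ : 0 < δ₀) (hA : B4.Hyp56 (chartSet Λ) (reOp Λ H) γ₀ c₀ δ₀)
    (hM : 5 ≤ M) (hMR : kR P.d 2 γ₀ c₀ δ₀ < M) (hMθ : thetaConst P.d 2 γ₀ c₀ δ₀ < M) (hθW : thetaW P.d 2 γ₀ c₀ δ₀ M < 1)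
    (x₁ x₂ : Balaban1983to89.Site P j) :
    ‖cLocC Λ H M ρ x₁ x₂‖ ≤
      2 * (2 ^ P.d * γ₀⁻¹ * (1 - thetaW P.d 2 γ₀ c₀ δ₀ M)⁻¹ * Real.exp (δ₀ / 4)) * Real.exp (-(δ₀ / 8) * (cdist x₁ x₂ / M)) := by
  have hK : 0 ≤ (2 ^ P.d * γ₀⁻¹ * (1 - thetaW P.d 2 γ₀ c₀ δ₀ M)⁻¹ * Real.exp (δ₀ / 4)) * Real.exp (-(δ₀ / 8) * (cdist x₁ x₂ / M)) := by
    have h1 : 0 < 1 - thetaW P.d 2 γ₀ c₀ δ₀ M := by linarith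
    positivity
  by_cases h : x₁ ∈ Λ ∧ x₂ ∈ Λ
  · have hre := abs_cLoc_le_walk hγ hc hδ hA hM hMR hMθ hθW ρ (⟨x₁, h.1⟩, 0) (⟨x₂, h.2⟩, 0)
    have him := abs_cLoc_le_walk hγ hc hδ hA hM hMR hMθ hθW ρ (⟨x₁, h.1⟩, 1) (⟨x₂, h.2⟩, 0)
    rw [cLocC_of_mem h.1 h.2]
    refine (norm_le_abs_re_add_abs_im _).trans ?_
    dsimp only at hre him ⊢
    linarith
  · rw [cLocC, dif_neg h, norm_zero]
    linarith

/-- **(2.47) IN COMPLEX FORM** — *"|C^{(k)}_{Λ,loc}(u; x₁, x₂) − C^{(k)}_Λ(u; x₁, x₂)| ≦ e^{−cr(e_k)}e^{−c|x₁−x₂|}"*: with `C_Λ = (H|_Λ)^{−1}` (p31's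
`(compress Λ H)⁻¹`), under [6] (5.6) and invertibility, `‖C_{Λ,loc}(x₁,x₂) − C_Λ(x₁,x₂)‖ ≤ 2·2^dγ₀^{−1}(1−θ_W)^{−1}e^{−(δ₀/16)(ρ−3)}·e^{−(δ₀/16)|x₁−x₂|_chart/M}`
on `Λ × Λ` — p31's `close247_walk` on the two real coordinates (`realify C ((x₁,Re),(x₂,Re)) = Re C(x₁,x₂)`, `((x₁,Im),(x₂,Re)) = Im C(x₁,x₂)`).
[cite: BalabanImbrieJaffe1988, (2.47) p.265] -/
theorem norm_cLocC_sub_inv_le_walk (hγ : 0 < γ₀) (hc : 0 ≤ c₀) (hδ : 0 < δ₀) (hA : B4.Hyp56 (chartSet Λ) (reOp Λ H) γ₀ c₀ δ₀)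
    (hU : IsUnit (compress Λ H)) (hM : 5 ≤ M) (hMR : kR P.d 2 γ₀ c₀ δ₀ < M) (hMθ : thetaConst P.d 2 γ₀ c₀ δ₀ < M)
    (hθW : thetaW P.d 2 γ₀ c₀ δ₀ M < 1) (x₁ x₂ : ↥Λ) :
    ‖cLocC Λ H M ρ x₁ x₂ - (compress Λ H)⁻¹ x₁ x₂‖ ≤
      2 * (2 ^ P.d * γ₀⁻¹ * (1 - thetaW P.d 2 γ₀ c₀ δ₀ M)⁻¹ * Real.exp (-(δ₀ / 16 * (ρ - 3)))) *
        Real.exp (-(δ₀ / 16) * (cdist x₁.1 x₂.1 / M)) := by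
  have h := close247_walk hγ hc hδ hA hU hM hMR hMθ hθW ρ
  have hre := h (x₁, 0) (x₂, 0)
  have him := h (x₁, 1) (x₂, 0)
  dsimp only at hre him
  rw [realify_apply_fst] at hre
  rw [realify_apply_snd] at him
  rw [cLocC_of_mem x₁.2 x₂.2]
  refine (norm_le_abs_re_add_abs_im _).trans ?_
  simp only [Complex.sub_re, Complex.sub_im]
  linarith

end LocalKernel

/-! ## §3  The correction of (3.30) WITH BODY: `C^{(0)}_{Λ,loc}(u₁) *ᵥ (Q(u₁)ᴴ *ᵥ ψ)` -/

section Correction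

variable (Λ : Finset (Balaban1983to89.Site P j)) (κ c : ℝ) (U : GaugeField P j U1) (M : ℕ) (ρ : ℝ)

/-- **THE CORRECTION `C^{(0)}_{loc}(u₁)Q*(u₁)ψ` OF (3.30) WITH BODY** (p. 270 *"φ = φ^{(0)} + aL^{−2}Λ₇^{(0)}C^{(0)}_{loc}(u₁)Q*(u₁)ψ. (3.30)"*): the
first-step local propagator — (2.43) for the (3.31) operator `−Δ_{u₁} + κQ(u₁)*Q(u₁)` = p31's `nOp κ c u₁ 1 univ` (`κ` = the printed `aL^{−2}`) with
Dirichlet region `Λ` — applied to `Q(u₁)*ψ`, `Q(u₁)` = p31's one-step covariant block-average matrix `qMatT u₁ 1` (= `qMatK u₁ 1 univ`, all blocks kept;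
its Gram matrix is p31's `pOp u₁`).  This is the site function entering r18's typed translation `phi330` as the data `corr`.
[cite: BalabanImbrieJaffe1988, (3.30) p.270] -/
def corr330 (ψ : Balaban1983to89.Site P (j + 1) → ℂ) : Balaban1983to89.Site P j → ℂ :=
  cLocC Λ (nOp κ c U 1 univ) M ρ *ᵥ ((qMatT U 1)ᴴ *ᵥ ψ)

variable {Λ κ c U M ρ}

/-- (3.30)'s correction unfolded: `(C^{(0)}_{Λ,loc}Q*ψ)(x) = Σ_{x′} C^{(0)}_{Λ,loc}(x,x′)(Q(u₁)ᴴψ)(x′)`. [cite: BalabanImbrieJaffe1988, (3.30) p.270] -/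
theorem corr330_apply (ψ : Balaban1983to89.Site P (j + 1) → ℂ) (x : Balaban1983to89.Site P j) :
    corr330 Λ κ c U M ρ ψ x = ∑ x', cLocC Λ (nOp κ c U 1 univ) M ρ x x' * ((qMatT U 1)ᴴ *ᵥ ψ) x' := rfl

/-- `Q(u) = qMatT u 1` (p31's gen-15 name for `qMatK u 1 univ`, all blocks kept) is the matrix used here; `corr330` over `qMatK u 1 univ` is the same
term. [cite: BalabanImbrieJaffe1988, (3.30) p.270] -/
theorem corr330_eq_qMatK (ψ : Balaban1983to89.Site P (j + 1) → ℂ) :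
    corr330 Λ κ c U M ρ ψ = cLocC Λ (nOp κ c U 1 univ) M ρ *ᵥ ((qMatK U 1 univ)ᴴ *ᵥ ψ) := rfl

/-- **`(Q(u)ᴴψ)(x) = conj(L^{−d}u(Γ_x))·ψ(y_x)`**: the adjoint block average spreads `ψ(y)` over the block `B(y)` with the conjugate transporter — one
term per site (`y_x` = the block of `x`, p11's `blkIter 1 x`; `u(Γ_x)` = p11's `holCK u 1 x`). [cite: BalabanImbrieJaffe1985, (4.6.1) p.313] -/
theorem qstar_mulVec_apply (U : GaugeField P j U1) (ψ : Balaban1983to89.Site P (j + 1) → ℂ) (x : Balaban1983to89.Site P j) :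
    ((qMatT U 1)ᴴ *ᵥ ψ) x = (starRingEnd ℂ) (((P.L : ℂ) ^ (1 * P.d))⁻¹ * holCK U 1 x) * ψ (blkIter 1 x) := by
  rw [mulVec, dotProduct]
  rw [Finset.sum_eq_single (blkIter 1 x)]
  · rw [conjTranspose_apply, qMatT_apply, if_pos (mem_blockK_blkIter 1 x), Complex.star_def]
  · intro y _ hy
    rw [conjTranspose_apply, qMatT_apply, if_neg, star_zero, zero_mul]
    intro hx
    exact hy (mem_blockK.1 hx).symm
  · intro h; exact absurd (mem_univ _) h

/-- **`‖(Q(u)ᴴψ)(x)‖ = L^{−d}‖ψ(y_x)‖`** (the transporter is unimodular, p11's `norm_holCK`). [cite: BalabanImbrieJaffe1985, (4.6.1) p.313] -/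
theorem norm_qstar_mulVec (U : GaugeField P j U1) (ψ : Balaban1983to89.Site P (j + 1) → ℂ) (x : Balaban1983to89.Site P j) :
    ‖((qMatT U 1)ᴴ *ᵥ ψ) x‖ = ((P.L : ℝ) ^ P.d)⁻¹ * ‖ψ (blkIter 1 x)‖ := by
  rw [qstar_mulVec_apply, norm_mul, Complex.norm_conj, norm_mul, norm_holCK, mul_one, one_mul, norm_inv, norm_pow,
    Complex.norm_natCast]

/-- the correction vanishes off the Dirichlet region `Λ` (rows of `C_{Λ,loc}`). [cite: BalabanImbrieJaffe1988, (3.30) p.270] -/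
theorem corr330_of_not_mem (ψ : Balaban1983to89.Site P (j + 1) → ℂ) {x : Balaban1983to89.Site P j} (hx : x ∉ Λ) :
    corr330 Λ κ c U M ρ ψ x = 0 := by
  rw [corr330_apply]
  exact Finset.sum_eq_zero fun x' _ => by rw [cLocC_of_not_mem_left hx, zero_mul]

/-- the correction is supported by the near columns: sites `x′` with `|x − x′|_chart/M > 2ρ` do not contribute ((2.43)'s vanishing clause).
[cite: BalabanImbrieJaffe1988, (3.30) p.270] -/
theorem corr330_eq_sum_filter (ψ : Balaban1983to89.Site P (j + 1) → ℂ) (x : Balaban1983to89.Site P j) :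
    corr330 Λ κ c U M ρ ψ x =
      ∑ x' ∈ univ.filter (fun x' => cdist x x' / M ≤ 2 * ρ), cLocC Λ (nOp κ c U 1 univ) M ρ x x' * ((qMatT U 1)ᴴ *ᵥ ψ) x' := by
  rw [corr330_apply, ← Finset.sum_filter_add_sum_filter_not univ (fun x' => cdist x x' / M ≤ 2 * ρ)]
  conv_rhs => rw [← add_zero (∑ x' ∈ _, _)]
  congr 1
  exact Finset.sum_eq_zero fun x' hx' => by
    rw [Finset.mem_filter, not_le] at hx'
    rw [cLocC_eq_zero_of_far hx'.2, zero_mul]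

end Correction

/-! ## §4  (3.30) AT the composed correction (r18's `phi330` BY NAME) and the (5.8.1) / `Ops.T` shape at kernel level -/

section Display

variable {Λ : Finset (Balaban1983to89.Site P j)} {κ c : ℝ} {U : GaugeField P j U1} {M : ℕ} {ρ : ℝ}

/-- **(3.30)** p. 270, verbatim: *"Again we make a local translation, φ = φ^{(0)} + aL^{−2}Λ₇^{(0)}C^{(0)}_{loc}(u₁)Q*(u₁)ψ. (3.30)"* — r18's `phi330` AT the
composed correction, INSIDE `Λ₇`: `φ(x) = φ^{(0)}(x) + aL^{−2}(C^{(0)}_{Λ,loc}(u₁)Q(u₁)*ψ)(x)` (`κ = aL^{−2}` inside the propagator as well).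
[cite: BalabanImbrieJaffe1988, (3.30) p.270] -/
theorem phi330_corr330_of_mem (a L : ℝ) {Λ₇ : Finset (Balaban1983to89.Site P j)} (φ0 : Balaban1983to89.Site P j → ℂ)
    (ψ : Balaban1983to89.Site P (j + 1) → ℂ) {x : Balaban1983to89.Site P j} (hx : x ∈ Λ₇) :
    phi330 Λ₇ a L φ0 (corr330 Λ (a * L ^ (-(2 : ℤ))) c U M ρ ψ) x =
      φ0 x + ((a * L ^ (-(2 : ℤ)) : ℝ) : ℂ) * corr330 Λ (a * L ^ (-(2 : ℤ))) c U M ρ ψ x := by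
  simp [phi330, hx]

/-- (3.30) OUTSIDE `Λ₇`: no translation, `φ(x) = φ^{(0)}(x)` (*"local translation"*; r18's `phi330_of_not_mem`). [cite: BalabanImbrieJaffe1988, (3.30) p.270] -/
theorem phi330_corr330_of_not_mem (a L : ℝ) {Λ₇ : Finset (Balaban1983to89.Site P j)} (φ0 : Balaban1983to89.Site P j → ℂ)
    (ψ : Balaban1983to89.Site P (j + 1) → ℂ) {x : Balaban1983to89.Site P j} (hx : x ∉ Λ₇) :
    phi330 Λ₇ a L φ0 (corr330 Λ (a * L ^ (-(2 : ℤ))) c U M ρ ψ) x = φ0 x :=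
  BIJ88Sect3Translations.phi330_of_not_mem a L φ0 _ hx

/-- (3.30) solved for the new variable: `φ^{(0)} = φ − aL^{−2}Λ₇C^{(0)}_{loc}(u₁)Q*(u₁)ψ` — the fluctuation field in which (3.31)/(3.33) are written; for
ANY correction data `corr` the field `φ0 := φ − aL^{−2}Λ₇corr` is the unique one with `phi330 Λ₇ a L φ0 corr = φ`. [cite: BalabanImbrieJaffe1988, (3.30) p.270] -/
theorem phi0_eq_sub (a L : ℝ) (Λ₇ : Finset (Balaban1983to89.Site P j)) (φ φ0 corr : Balaban1983to89.Site P j → ℂ) :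
    phi330 Λ₇ a L φ0 corr = φ ↔ φ0 = fun x => φ x - if x ∈ Λ₇ then ((a * L ^ (-(2 : ℤ)) : ℝ) : ℂ) * corr x else 0 := by
  constructor
  · intro h
    funext x
    have hx := congrFun h x
    rw [phi330] at hx
    rw [← hx]
    ring
  · intro h
    funext x
    rw [phi330, h]
    ring

/-- **THE (5.8.1) / `Ops.T` SHAPE AT KERNEL LEVEL**: (3.30) with the composed correction is the affine map `φ = φ^{(0)} + (aL^{−2})·(1_{Λ₇}·C^{(0)}_{Λ,loc}(u₁)·
Q(u₁)ᴴ)ψ` — p31's projection `proj Λ₇`, the local kernel and the adjoint block average composed as MATRICES (r16's End-carrier `BIJ88ScalarSummary583.Ops.T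
= a • (Λ7 ∘ₗ Cloc ∘ₗ Qst)`, (5.8.1) *"φ = φ^{(k)} + aL^{−2}Λ₇^{(k)}C^{(k)}_{loc}(u_{k+1})Q*(ũ_{k+1})ψ"*, read on kernels at `k = 0`).
[cite: BalabanImbrieJaffe1988, (3.30) p.270] -/
theorem phi330_corr330_eq_mulVec (a L : ℝ) (Λ₇ : Finset (Balaban1983to89.Site P j)) (φ0 : Balaban1983to89.Site P j → ℂ)
    (ψ : Balaban1983to89.Site P (j + 1) → ℂ) :
    phi330 Λ₇ a L φ0 (corr330 Λ (a * L ^ (-(2 : ℤ))) c U M ρ ψ) =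
      φ0 + ((a * L ^ (-(2 : ℤ)) : ℝ) : ℂ) • ((proj Λ₇ * cLocC Λ (nOp (a * L ^ (-(2 : ℤ))) c U 1 univ) M ρ * (qMatT U 1)ᴴ) *ᵥ ψ) := by
  funext x
  rw [Pi.add_apply, Pi.smul_apply, ← mulVec_mulVec, ← mulVec_mulVec, proj_mulVec, smul_eq_mul, phi330]
  by_cases hx : x ∈ Λ₇
  · rw [if_pos hx, if_pos hx]; rfl
  · rw [if_neg hx, if_neg hx, mul_zero]

end Display

end

end Literature.MathematicalPhysics.QuantumFieldTheory.BalabanImbrieJaffe1984to88.BIJ88ScalarTranslation330Torus
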